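import Summits.Langlands.Langlands.Statement
import Literature.NumberTheory.EllipticCurves.FramedTateGaloisRep
import Literature.NumberTheory.Automorphic.ThorneQInfinityModular
import Literature.NumberTheory.Automorphic.GLnAdelicStructureProofs
import HarnessLib

/-!
# `Lines/AbelianEllipticAwayFiveSeven_onpath` — F4 on-path lemma (forward generator G4, generation 28)

`Langlands → EllipticGaloisToAutomorphicOn 𝒦` for EVERY class `𝒦` of totally real fields (in particular the rung
`AbelianEllipticAwayFiveSeven = EllipticAbelianTR {5,7}` and every higher rung `EllipticAbelianTR T`, `T ⊆ {5,7}`):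
the summit's clause (B) at rank `2` over `K`, applied to the framed dual Tate module `ρ_{E,ℓ}^∨` of an integral model
`E / 𝓞 K` with elliptic generic fibre, for the reciprocity datum the summit provides (`Nonempty (ReciprocityData K)` +
the `∀ 𝓡` clause of the 2026-08-17 Statement); `IsGeometricFramed` from
`WeierstrassCurve.eventually_isUnramifiedAt_framedTateGaloisRepDual` and the rung's de Rham hypothesis; shift `m = 1`.
(`E → rung` for the crux E itself: skeleton §5.)  No `sorry`.
-/

noncomputable section

set_option linter.dupNamespace false

open scoped MatrixGroups Matrix NumberField Classical Polynomial
open Filter IsDedekindDomain Field Polynomial WeierstrassCurve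
open Literature.NumberTheory.Automorphic Literature.NumberTheory.GaloisRepresentations
open Literature.NumberTheory.EllipticCurves
open Literature.NumberTheory.PAdicHodge
open Summit.Langlands

namespace Summit.Langlands.Langlands.Cruxes.ReciprocityUpToIrreducibility.AbelianEllipticAwayFiveSeven

/-! ## 1. The dial: classes of totally real number fields -/

/-- `K/ℚ` is abelian: Galois with commuting automorphisms. [folklore] -/
def IsAbelianOverQ (K : Type) [Field K] [NumberField K] : Prop :=
  IsGalois ℚ K ∧ ∀ σ τ : K ≃ₐ[ℚ] K, σ * τ = τ * σ

/-- `K` is unramified at every rational prime of `T`: `p ∤ disc K` (Dedekind). [folklore] -/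
def UnramifiedAtPrimes (T : Finset ℕ) (K : Type) [Field K] [NumberField K] : Prop :=
  ∀ p ∈ T, ¬ ((p : ℤ) ∣ NumberField.discr K)

/-- The class "abelian over `ℚ` and unramified at the primes of `T`". [folklore] -/
def AbelianAwayFrom (T : Finset ℕ) : ∀ (K : Type) [Field K] [NumberField K], Prop :=
  fun K _ _ => IsAbelianOverQ K ∧ UnramifiedAtPrimes T K

/-- The class of layers of the cyclotomic `ℤ_p`-towers of `ℚ` (some prime `p`; Thorne 2019). [folklore] -/
def CyclotomicTowerLayer : ∀ (K : Type) [Field K] [NumberField K], Prop :=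
  fun K _ _ => ∃ p : ℕ, p.Prime ∧ Thorne2019.IsInCyclotomicZpExtension p K

/-! ## 2. The rung family (clause (B), `n = 2`, elliptic sector, Galois-side, archimedean-free) -/

/-- **The RUNG FAMILY over a class `𝒦` of totally real fields**: for every totally real number field `K` in
the class `𝒦`, every integral Weierstrass model `E / 𝓞 K` with elliptic generic fibre, every prime `ℓ` and
`ι : ℚ̄_ℓ ≃+* ℂ`: if `ρ := ρ_{E,ℓ}^∨` is irreducible and de Rham above `ℓ` (pinned Fontaine datum), then there
are a cuspidal automorphic representation `π` of `GL₂(𝔸_K)` and a shift `m` such that at all but finitely many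
finite places `v`, `π_v` is unramified with Satake parameter `α`, `ρ` is unramified at `v` and every arithmetic
Frobenius at `v` has characteristic polynomial `arithFrobPolyOfSatake ι q_v m α` on `ρ` (verbatim the conclusion
of generation 6's `EllipticGaloisToAutomorphicTR`, whose degree hypothesis is replaced by `𝒦 K`). -/
def EllipticGaloisToAutomorphicOn (𝒦 : ∀ (K : Type) [Field K] [NumberField K], Prop) : Prop :=
  ∀ (K : Type) [Field K] [NumberField K] [NumberField.IsTotallyReal K], 𝒦 K →
    ∀ (E : WeierstrassCurve (𝓞 K)) [(E.baseChange K).IsElliptic] (ℓ : ℕ) [Fact ℓ.Prime]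
      (ι : PadicAlgCl ℓ ≃+* ℂ),
      ((E.baseChange K).framedTateGaloisRepDual ℓ).toGaloisRep.IsIrreducible →
      (∀ (v : HeightOneSpectrum (𝓞 K)) (hv : ((ℓ : ℕ) : 𝓞 K) ∈ v.asIdeal),
          (fontainePstAdicCompletion v ℓ hv).IsDeRhamFramed
            (((E.baseChange K).framedTateGaloisRepDual ℓ).toLocal v)) →
      ∃ (hK : isCompact_glFiniteIntegralLevel 2 K) (π : CuspidalAutomorphicRepData 2 K hK) (m : ℕ),
        ∀ᶠ v : HeightOneSpectrum (𝓞 K) in Filter.cofinite, ∃ α : Multiset ℂ,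
          π.1.HasSatakeParamAt v α ∧
          ((E.baseChange K).framedTateGaloisRepDual ℓ).IsUnramifiedAt v ∧
          ((E.baseChange K).framedTateGaloisRepDual ℓ).HasFrobCharpolyAt v
            (arithFrobPolyOfSatake ι v.residueCard m α)

/-- **THE DIAL as a one-parameter family**: `T ⊆ {3,5,7}` ↦ the family over abelian totally real fields
unramified at the primes of `T`. -/
def EllipticAbelianTR (T : Finset ℕ) : Prop := EllipticGaloisToAutomorphicOn (AbelianAwayFrom T)

/-- **THE RUNG** (the filed statement): `T = {5,7}` — clause (B) for the Tate modules of elliptic curves over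
every abelian totally real field unramified at `5` and `7` (ramification at `3` allowed). -/
def AbelianEllipticAwayFiveSeven : Prop := EllipticAbelianTR {5, 7}

/-- Class monotonicity: a bigger class gives a stronger statement. [folklore] -/
theorem ellipticGaloisToAutomorphicOn_mono {𝒦 𝒦' : ∀ (K : Type) [Field K] [NumberField K], Prop}
    (h𝒦 : ∀ (K : Type) [Field K] [NumberField K], 𝒦 K → 𝒦' K)
    (h : EllipticGaloisToAutomorphicOn 𝒦') : EllipticGaloisToAutomorphicOn 𝒦 :=
  fun K _ _ _ hK => h K (h𝒦 K hK)

/-- **Dial monotonicity**: `T ⊆ T'` ⇒ `EllipticAbelianTR T → EllipticAbelianTR T'`. [folklore] -/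
theorem ellipticAbelianTR_mono {T T' : Finset ℕ} (hTT' : T ⊆ T') (h : EllipticAbelianTR T) :
    EllipticAbelianTR T' :=
  ellipticGaloisToAutomorphicOn_mono (fun K _ _ hK => ⟨hK.1, fun p hp => hK.2 p (hTT' hp)⟩) h

/-- The rung implies the floor's family value (`{5,7} ⊆ {3,5,7}`): the ladder is ordered. [folklore] -/
theorem floorFamily_of_rung (h : AbelianEllipticAwayFiveSeven) : EllipticAbelianTR {3, 5, 7} :=
  ellipticAbelianTR_mono (by decide) h

/-! ## 5. On-path (F4): the summit, and the crux E itself, give every class — in particular the rung -/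

/-- `Langlands → EllipticGaloisToAutomorphicOn 𝒦` for every class `𝒦` (clause (B) at rank 2 for the summit's
reciprocity datum, applied to `ρ_{E,ℓ}^∨`, shift `m = 1`). -/
theorem ellipticGaloisToAutomorphicOn_of_langlands (𝒦 : ∀ (K : Type) [Field K] [NumberField K], Prop)
    (hL : _root_.Langlands) : EllipticGaloisToAutomorphicOn 𝒦 := by
  intro K _ _ _ _hK E _ ℓ _ ι hirr hdR
  obtain ⟨⟨Rec⟩, hall⟩ := hL K
  have hcpt : isCompact_glFiniteIntegralLevel 2 K := isCompact_glFiniteIntegralLevel_holds 2 K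
  have hB : GaloisToAutomorphic 2 Rec hcpt := (hall Rec 2 two_pos hcpt).2
  have hgeo : IsGeometricFramed Rec ((E.baseChange K).framedTateGaloisRepDual ℓ) :=
    ⟨(E.baseChange K).eventually_isUnramifiedAt_framedTateGaloisRepDual ℓ, fun v hv => hdR v hv⟩
  obtain ⟨π, -, hcorr⟩ := hB ℓ ι _ hirr hgeo
  refine ⟨hcpt, π, 1, ?_⟩
  filter_upwards [hcorr.1] with v hv
  exact hv

/-- **F4 on-path lemma for the rung**: `Langlands → AbelianEllipticAwayFiveSeven`. -/
@[aesop safe apply]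
theorem AbelianEllipticAwayFiveSeven_of_Langlands (hL : _root_.Langlands) : AbelianEllipticAwayFiveSeven :=
  ellipticGaloisToAutomorphicOn_of_langlands _ hL

/-! `E → rung` (the crux itself gives the rung: `ellipticGaloisToAutomorphicOn_of_top`,
`AbelianEllipticAwayFiveSeven_of_top`) is proved in the skeleton `Lines/AbelianEllipticAwayFiveSeven.lean` §5, which
imports the route file; this file imports only the Statement. -/

end Summit.Langlands.Langlands.Cruxes.ReciprocityUpToIrreducibility.AbelianEllipticAwayFiveSeven

end
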